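import Mathlib
import HarnessLib

/-!
# LINE (A) `product_plus_one` (crux `MatrixDescartes`, stmt-ValiantsHypothesis-18050, V1) — THE PHASE LENS, TWO-KILL CLOUD PROFILE (pure algebra):
# the `D_{π/b}D_{π/c}`-image of a trinomial row is `αβ·X^a·sin(aπ/b)·sin(aπ/c)·E(X)/(Q₊Q₋)` with an explicit FIVE-NOMIAL `E`

Companion of ✓ `…ProductPlusOneLensAlgebra` (σ/τ letters, p5 g17) and `…ProductPlusOneLensCloudProfiles` ((C1)/(C5), p5 g17).
Source: val-lit-p3 g20's phase-lens NOTE `pub/val-lit/lmr/NOTE-p3g20-18050-phase-lens.md` (§3.2 step 3, §6‴ Theorem C), pen memo §37.2,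
and val-idea-crit-1 g8 VERDICT #315 (the `E`-quintinomial, «yours to bank»).  For a trinomial row `f = α + βx^a + γx^c` (`c = a + b`) write
`s = X^a`, `t = X^c`; on the horizontal line of height `h` one has `Re T_f(u+ih) = Re(N·D̄)/|D|²` with
`Re(N·D̄) = aαβ·s·cos(ah) + aβ²s² + cγ²t² + cαγ·t·cos(ch) + (a+c)βγ·s·t·cos(bh)` and
`|D|² = α² + β²s² + γ²t² + 2αβ·s·cos(ah) + 2αγ·t·cos(ch) + 2βγ·s·t·cos(bh)`.  At the two heights `η± = π/b ± π/c`
the cosines `cos(cη±) = −cos(cπ/b)` and `cos(bη±) = −cos(bπ/c)` AGREE, only `κ± = cos(aη±)` differ, so `Re T_f` is ONE Möbius function of `κ`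
evaluated at two points, and the two-kill profile `−½[Re T_f(u+iη₊) − Re T_f(u+iη₋)]` collapses.  THIS FILE (no analysis, no zero counting):
* `lens_moebius_sub` — `(Pk₁+R)/(Uk₁+S) − (Pk₂+R)/(Uk₂+S) = (k₁−k₂)(PS−RU)/((Uk₁+S)(Uk₂+S))`;
* ★ `lens_twoKill_E_identity` — with `R₀, S₀` the `κ`-free parts above (cosines as real parameters `Cc = cos(cη±)`, `Cb = cos(bη±)`),
  `a·S₀ − 2·R₀ = E`, **`E = aα² − aβ²s² − (2c−a)γ²t² − 2(c−a)αγ·Cc·t − 2cβγ·Cb·s·t`** (`ring`); with `Cc = −cos(cπ/b)`, `Cb = −cos(bπ/c)` this is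
  crit-1's `E(X) = aα² − aβ²X^{2a} + 2bαγcos(cπ/b)X^c + 2cβγcos(bπ/c)X^{a+c} − (2c−a)γ²X^{2c}` (★ `lens_twoKill_E_eq`);
* ★ `lens_twoKill_profile` — `ReT κp − ReT κm = (κp − κm)·(αβs)·E/(Q₊Q₋)`, `Q± = 2αβsκ± + S₀` (the row's `|D(u+iη±)|²`);
* `lens_cos_add_sub_cos_sub` — `cos(x+y) − cos(x−y) = −2 sin x sin y`, so `−½(κp−κm) = sin(aπ/b)·sin(aπ/c)`; the height facts
  `lens_cos_c_eta±` (`cos(c(π/b ± π/c)) = −cos(cπ/b)`), `lens_cos_b_eta±` (`cos((c−a)(π/(c−a) ± π/c)) = −cos((c−a)π/c)`);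
* `lens_twoKill_E_arow` — the a-row case `γ = 0`: `E = a(α² − β²s²)` (the NOTE's `X(1−X²)` terminal summand, one node);
* `lens_cos_bpi_div_c_neg` — for `0 < a < b`, `cos(bπ/(a+b)) < 0` (the sign fact behind crit-1's Descartes table: the `X^{a+c}` coefficient of `E`
  has the sign of `−βγ`).
HONEST FRAMING: algebra/trigonometry of one row (helper); the lens's counts (NOTE Theorems A/B/C/W) are PAPER and are not claimed here; nothing
about `WronskianBudgetK3` / `OneChangeFloorK3` / the stubs / 18050 / `MatrixDescartes`; `VP ≠ VNP` is NOT proved.  No definitions, no named facts, no sorry.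
-/

set_option linter.dupNamespace false

namespace Summit.ValiantsHypothesis.ValiantsHypothesis.Theorems.LacunarySymmetroidMatrixDescartes

namespace ProductPlusOne

/-! ### §1 The Möbius difference -/

/-- **Möbius difference**: two values of `k ↦ (Pk + R)/(Uk + S)` differ by `(k₁ − k₂)(PS − RU)/((Uk₁+S)(Uk₂+S))`. [folklore] -/
theorem lens_moebius_sub (P R U S k₁ k₂ : ℝ) (h₁ : U * k₁ + S ≠ 0) (h₂ : U * k₂ + S ≠ 0) :
    (P * k₁ + R) / (U * k₁ + S) - (P * k₂ + R) / (U * k₂ + S)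
      = (k₁ - k₂) * (P * S - R * U) / ((U * k₁ + S) * (U * k₂ + S)) := by
  rw [div_sub_div _ _ h₁ h₂]
  congr 1
  ring

/-! ### §2 The five-nomial `E` -/

/-- ★ **The `E`-identity**: with `R₀ = aβ²s² + cγ²t² + cαγ·Cc·t + (a+c)βγ·Cb·s·t` (the `κ`-free part of `Re(N·D̄)`) and
`S₀ = α² + β²s² + γ²t² + 2αγ·Cc·t + 2βγ·Cb·s·t` (the `κ`-free part of `|D|²`), one has `a·S₀ − 2·R₀ = E`. [this file's theorem] -/
theorem lens_twoKill_E_identity (a c α β γ s t Cc Cb : ℝ) :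
    a * (α ^ 2 + β ^ 2 * s ^ 2 + γ ^ 2 * t ^ 2 + 2 * α * γ * Cc * t + 2 * β * γ * Cb * s * t)
      - 2 * (a * β ^ 2 * s ^ 2 + c * γ ^ 2 * t ^ 2 + c * α * γ * Cc * t + (a + c) * β * γ * Cb * s * t)
      = a * α ^ 2 - a * β ^ 2 * s ^ 2 - (2 * c - a) * γ ^ 2 * t ^ 2 - 2 * (c - a) * α * γ * Cc * t
        - 2 * c * β * γ * Cb * s * t := by
  ring

/-- ★ **`E` in crit-1's spelling**: substituting the height facts `Cc = −cos(cπ/b)`, `Cb = −cos(bπ/c)` (`b = c − a`),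
`E = aα² − aβ²s² + 2bαγ·cos(cπ/b)·t + 2cβγ·cos(bπ/c)·s·t − (2c−a)γ²t²`. [this file's theorem] -/
theorem lens_twoKill_E_eq (a c α β γ s t cc cb : ℝ) :
    a * α ^ 2 - a * β ^ 2 * s ^ 2 - (2 * c - a) * γ ^ 2 * t ^ 2 - 2 * (c - a) * α * γ * (-cc) * t
        - 2 * c * β * γ * (-cb) * s * t
      = a * α ^ 2 - a * β ^ 2 * s ^ 2 + 2 * (c - a) * α * γ * cc * t + 2 * c * β * γ * cb * s * t
        - (2 * c - a) * γ ^ 2 * t ^ 2 := by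
  ring

/-- **The a-row case** (`γ = 0`): `E = a(α² − β²s²)` — one node at `βs = ±α`, the NOTE's terminal summand `X(1 − X²)`. [this file's lemma] -/
theorem lens_twoKill_E_arow (a c α β s t Cc Cb : ℝ) :
    a * α ^ 2 - a * β ^ 2 * s ^ 2 - (2 * c - a) * (0 : ℝ) ^ 2 * t ^ 2 - 2 * (c - a) * α * 0 * Cc * t
        - 2 * c * β * 0 * Cb * s * t
      = a * (α ^ 2 - β ^ 2 * s ^ 2) := by
  ring

/-! ### §3 The assembled two-kill profile -/

/-- ★ **THE TWO-KILL PROFILE OF A TRINOMIAL ROW.**  Let `ReT κ := (aαβ·s·κ + R₀)/(2αβ·s·κ + S₀)` (the real part of `θ log f` on a line where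
`cos(ah) = κ` and the other two cosines are `Cc`, `Cb`).  Then for the two heights `η±` (same `Cc`, `Cb`, cosines `κp`, `κm`):
`ReT κp − ReT κm = (κp − κm)·(αβs)·E/(Q₊·Q₋)` with `Q± = 2αβsκ± + S₀ = |D(u+iη±)|²` and `E` the five-nomial of
`lens_twoKill_E_identity`.  (With `−½(κp − κm) = sin(aπ/b)sin(aπ/c)` this is the NOTE's/crit-1's
`D_{π/b}D_{π/c}T_f = αβ·X^a·sin(aπ/b)sin(aπ/c)·E/(Q₊Q₋)`.) [this file's theorem] -/
theorem lens_twoKill_profile (a c α β γ s t Cc Cb κp κm : ℝ)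
    (hp : 2 * α * β * s * κp + (α ^ 2 + β ^ 2 * s ^ 2 + γ ^ 2 * t ^ 2 + 2 * α * γ * Cc * t + 2 * β * γ * Cb * s * t) ≠ 0)
    (hm : 2 * α * β * s * κm + (α ^ 2 + β ^ 2 * s ^ 2 + γ ^ 2 * t ^ 2 + 2 * α * γ * Cc * t + 2 * β * γ * Cb * s * t) ≠ 0) :
    (a * α * β * s * κp + (a * β ^ 2 * s ^ 2 + c * γ ^ 2 * t ^ 2 + c * α * γ * Cc * t + (a + c) * β * γ * Cb * s * t))
        / (2 * α * β * s * κp + (α ^ 2 + β ^ 2 * s ^ 2 + γ ^ 2 * t ^ 2 + 2 * α * γ * Cc * t + 2 * β * γ * Cb * s * t))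
      - (a * α * β * s * κm + (a * β ^ 2 * s ^ 2 + c * γ ^ 2 * t ^ 2 + c * α * γ * Cc * t + (a + c) * β * γ * Cb * s * t))
        / (2 * α * β * s * κm + (α ^ 2 + β ^ 2 * s ^ 2 + γ ^ 2 * t ^ 2 + 2 * α * γ * Cc * t + 2 * β * γ * Cb * s * t))
      = (κp - κm) * (α * β * s)
          * (a * α ^ 2 - a * β ^ 2 * s ^ 2 - (2 * c - a) * γ ^ 2 * t ^ 2 - 2 * (c - a) * α * γ * Cc * t
              - 2 * c * β * γ * Cb * s * t)
          / ((2 * α * β * s * κp + (α ^ 2 + β ^ 2 * s ^ 2 + γ ^ 2 * t ^ 2 + 2 * α * γ * Cc * t + 2 * β * γ * Cb * s * t))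
            * (2 * α * β * s * κm + (α ^ 2 + β ^ 2 * s ^ 2 + γ ^ 2 * t ^ 2 + 2 * α * γ * Cc * t + 2 * β * γ * Cb * s * t))) := by
  rw [div_sub_div _ _ hp hm]
  congr 1
  ring

/-! ### §4 Trigonometric inputs: the two heights, the prefactor, one sign -/

/-- `cos(x + y) − cos(x − y) = −2·sin x·sin y` (so `−½(κp − κm) = sin(aπ/b)·sin(aπ/c)` for `κ± = cos(aπ/b ± aπ/c)`). [folklore] -/
theorem lens_cos_add_sub_cos_sub (x y : ℝ) :
    Real.cos (x + y) - Real.cos (x - y) = -2 * Real.sin x * Real.sin y := by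
  rw [Real.cos_add, Real.cos_sub]
  ring

/-- At the heights `η± = π/b ± π/c` the `c`-letter's cosine is the same: `cos(c·(π/b + π/c)) = −cos(c·π/b)` (`c ≠ 0`). [this file's lemma] -/
theorem lens_cos_c_eta_plus (b c : ℝ) (hc : c ≠ 0) :
    Real.cos (c * (Real.pi / b + Real.pi / c)) = -Real.cos (c * Real.pi / b) := by
  have : c * (Real.pi / b + Real.pi / c) = c * Real.pi / b + Real.pi := by
    rw [mul_add, mul_div_assoc', mul_div_assoc', mul_div_cancel_left₀ _ hc]
  rw [this, Real.cos_add_pi]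

/-- `cos(c·(π/b − π/c)) = −cos(c·π/b)` (`c ≠ 0`). [this file's lemma] -/
theorem lens_cos_c_eta_minus (b c : ℝ) (hc : c ≠ 0) :
    Real.cos (c * (Real.pi / b - Real.pi / c)) = -Real.cos (c * Real.pi / b) := by
  have : c * (Real.pi / b - Real.pi / c) = c * Real.pi / b - Real.pi := by
    rw [mul_sub, mul_div_assoc', mul_div_assoc', mul_div_cancel_left₀ _ hc]
  rw [this, Real.cos_sub_pi]

/-- At the heights `η±` the `b`-letter's cosine is the same: `cos(b·(π/b + π/c)) = −cos(b·π/c)` (`b ≠ 0`). [this file's lemma] -/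
theorem lens_cos_b_eta_plus (b c : ℝ) (hb : b ≠ 0) :
    Real.cos (b * (Real.pi / b + Real.pi / c)) = -Real.cos (b * Real.pi / c) := by
  have : b * (Real.pi / b + Real.pi / c) = b * Real.pi / c + Real.pi := by
    rw [mul_add, mul_div_assoc', mul_div_assoc', mul_div_cancel_left₀ _ hb, add_comm]
  rw [this, Real.cos_add_pi]

/-- `cos(b·(π/b − π/c)) = −cos(b·π/c)` (`b ≠ 0`; `cos` is even). [this file's lemma] -/
theorem lens_cos_b_eta_minus (b c : ℝ) (hb : b ≠ 0) :
    Real.cos (b * (Real.pi / b - Real.pi / c)) = -Real.cos (b * Real.pi / c) := by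
  have : b * (Real.pi / b - Real.pi / c) = Real.pi - b * Real.pi / c := by
    rw [mul_sub, mul_div_assoc', mul_div_assoc', mul_div_cancel_left₀ _ hb]
  rw [this, Real.cos_pi_sub]

/-- **Sign fact**: for `0 < a < b`, `cos(b·π/(a+b)) < 0` (since `π/2 < bπ/(a+b) < π`); hence the `X^{a+c}` coefficient
`2cβγ·cos(bπ/c)` of `E` has the sign of `−βγ` (crit-1 #315's Descartes table). [this file's lemma] -/
theorem lens_cos_bpi_div_c_neg (a b : ℝ) (ha : 0 < a) (hab : a < b) :
    Real.cos (b * Real.pi / (a + b)) < 0 := by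
  have hc : 0 < a + b := by linarith
  apply Real.cos_neg_of_pi_div_two_lt_of_lt
  · rw [lt_div_iff₀ hc]
    nlinarith [Real.pi_pos]
  · rw [div_lt_iff₀ hc]
    nlinarith [Real.pi_pos]

end ProductPlusOne

end Summit.ValiantsHypothesis.ValiantsHypothesis.Theorems.LacunarySymmetroidMatrixDescartes
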